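import Summits.NavierStokesRegularity.NavierStokesRegularity.Theses.QuarterTurnRdss
import Literature.Analysis.FluidPDE.TypeIAncientMild

/-!
# Birth skeleton (BC3) for the split piece `TwistedCellExists` — crux `QuarterTurnProfileExists`
# (stmt-NavierStokesRegularity-1100), route `QuarterTurnRdss`, summit NavierStokesRegularity (negative side)

Line `birth` = **"defect cells + closing lemma"** for the ∃-piece of the period-cell split (crux-strategist
seat `cstrat-stmt-NavierStokesRegularity-1100-r1`). The piece asks for ONE exact twisted cell: a field `v` on
the model period `[-1, -c⁻²] × ℝ³` (quarter-turn `R`, `c > 1`), jointly continuous, bounded, weakly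
divergence free, solving the Oseen (KNSS) integral equation between all pairs of model times and closing up
under the twisted zoom `v(-c⁻², x) = c R⁻¹ v(-1, cRx)`, with `v(-1)` neither a.e. zero nor a.e.
`R`-equivariant — a fixed point of the twisted period map of the Navier–Stokes flow. The line separates the
ANALYTIC interface from the CONSTRUCTIVE content:

* `stub_approximate_cells` (XL, open — the constructive / computational content): for some `c > 1`, the
  quarter-turn `R`, and constants `M` (sup bound), `L` (joint Lipschitz modulus on the period), `m > 0`
  (non-degeneracy) and points `y₀, y₁`, there is for EVERY `ε > 0` a DEFECT CELL: an `L`-Lipschitz,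
  `M`-bounded, weakly divergence-free field on the period whose Oseen residual
  `‖v(t) − e^{(t-s)Δ}v(s) + B¹_s(v,v)(t)‖_∞` and junction residual `‖v(-c⁻²,·) − c R⁻¹v(-1, cR·)‖_∞` are
  `≤ ε`, with the pointwise witnesses `‖v(-1,y₀)‖ ≥ m` (nontriviality) and
  `‖v(-1,Ry₁) − R v(-1,y₁)‖ ≥ m` (genuine twist). This is where the physical seed enters: the
  pair → sheet → perpendicular-pair cycle (MckeownEtAl2020, BrennerHormozPumir2016 §VI iteration map) as the
  initial guess of a Galerkin/Newton computation of the twisted period map in similarity variables; the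
  uniformity of `(M, L, m)` in `ε` is the whole difficulty (it is equivalent to the piece by the closing
  lemma and the smoothing estimates of bounded mild solutions). A SINGLE certificate suffices once a
  radii-polynomial (Newton–Kantorovich) upgrade is typed — the intended refinement of this stub.
* `stub_closing_lemma` (L, provable): uniformly Lipschitz, uniformly bounded defect cells with residuals
  `→ 0` have a locally uniform subsequential limit which is an EXACT twisted cell keeping the witnesses —
  Arzelà–Ascoli on the compact pieces `[-1,-c⁻²] × B̄(0,n)` with a diagonal extraction (tree:
  `exists_strictMono_tendstoUniformlyOn_of_bound`, `AncientMildCompactness.lean`), dominated convergence in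
  the weak divergence condition, in the caloric term and in the Oseen–Duhamel term
  (`tendsto_heatExtension_of_tendsto_of_bound`, `tendsto_oseenDuhamel_of_tendsto_of_bound`), pointwise limits
  in the junction and in the two witness inequalities.

Composition `TwistedCellExists_of` (kernel-checked): the limit cell's slice `v(-1)` is continuous
(Lipschitz), so "a.e. zero" would force `v(-1) = 0` (`Measure.eq_of_ae_eq`), contradicting
`‖v(-1,y₀)‖ ≥ m > 0`; likewise a.e. `R`-equivariance would force equality of the two continuous fields
`v(-1) ∘ R` and `R ∘ v(-1)` at `y₁`.

Until `route edit --split QuarterTurnProfileExists` has rendered the piece, the piece is the LOCAL verbatim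
copy `TwistedCellExists` below (same text as children.json); afterwards replace it by
`Summit.NavierStokesRegularity.NavierStokesRegularity.Theses.QuarterTurnRdss.TwistedCellExists` (`Iff.rfl`).

Disproof used: none — no `Disproof.lean` / Negative lemma exists for this crux (`ledger crux ls`, 2026-08-17);
the stub set honours the known removals: Chae–Wolf 2017 Thm 1.3 (via the route's `NearIdentityRemoval`)
constrains the `c` of stub 1 to `c⁴ ≥ λ_*`, and an axisymmetric guess is excluded (KNSS 2009 Thm 5.3) —
the twist witness `y₁` forbids it anyway.
-/

noncomputable section

namespace Summit.NavierStokesRegularity.NavierStokesRegularity.Cruxes.TwistedCellExists.Birth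

open MeasureTheory Set Function Filter
open Literature.Analysis.FluidPDE

set_option linter.dupNamespace false

/-! ## The piece (local verbatim copy) and the two statements of the line -/

/-- LOCAL verbatim copy of the split piece `QuarterTurnRdss.TwistedCellExists` (children.json). -/
def TwistedCellExists : Prop :=
  ∃ c : ℝ, 1 < c ∧ ∃ R : EuclideanSpace ℝ (Fin 3) ≃ₗᵢ[ℝ] EuclideanSpace ℝ (Fin 3), (∀ x : EuclideanSpace ℝ (Fin 3), (R x) 0 = -(x 1) ∧ (R x) 1 = x 0 ∧ (R x) 2 = x 2) ∧ ∃ v : ℝ → EuclideanSpace ℝ (Fin 3) → EuclideanSpace ℝ (Fin 3), (ContinuousOn (Function.uncurry v) (Set.Icc (-1 : ℝ) (-(c ^ 2)⁻¹) ×ˢ Set.univ) ∧ (∃ M : ℝ, ∀ t ∈ Set.Icc (-1 : ℝ) (-(c ^ 2)⁻¹), ∀ x, ‖v t x‖ ≤ M) ∧ (∀ t ∈ Set.Icc (-1 : ℝ) (-(c ^ 2)⁻¹), Literature.Analysis.FluidPDE.IsWeaklyDivFree (v t)) ∧ (∀ s t : ℝ, -1 ≤ s → s < t → t ≤ -(c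 ^ 2)⁻¹ → ∀ x, v t x = Literature.Analysis.FluidPDE.heatFlow (v s) (t - s) x - Literature.Analysis.FluidPDE.oseenDuhamel 1 s v v t x) ∧ (∀ x, v (-(c ^ 2)⁻¹) x = c • R.symm (v (-1) (c • R x)))) ∧ ¬ (v (-1) =ᵐ[volume] 0) ∧ ¬ ((fun x => v (-1) (R x)) =ᵐ[volume] fun x => R (v (-1) x))

/-- Statement of stub 1 (defect cells with uniform bounds and non-degeneracy witnesses). -/
def ApproximateCells : Prop :=
  ∃ c : ℝ, 1 < c ∧ ∃ R : EuclideanSpace ℝ (Fin 3) ≃ₗᵢ[ℝ] EuclideanSpace ℝ (Fin 3), (∀ x : EuclideanSpace ℝ (Fin 3), (R x) 0 = -(x 1) ∧ (R x) 1 = x 0 ∧ (R x) 2 = x 2) ∧ ∃ (M m : ℝ) (L : NNReal) (y₀ y₁ : EuclideanSpace ℝ (Fin 3)), 0 < m ∧ ∀ ε : ℝ, 0 < ε → ∃ v : ℝ → EuclideanSpace ℝ (Fin 3) → EuclideanSpace ℝ (Fin 3), (LipschitzOnWith L (Function.uncurry v) (Set.Icc (-1 : ℝ) (-(c ^ 2)⁻¹)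 ×ˢ Set.univ) ∧ (∀ t ∈ Set.Icc (-1 : ℝ) (-(c ^ 2)⁻¹), ∀ x, ‖v t x‖ ≤ M) ∧ (∀ t ∈ Set.Icc (-1 : ℝ) (-(c ^ 2)⁻¹), Literature.Analysis.FluidPDE.IsWeaklyDivFree (v t)) ∧ (∀ s t : ℝ, -1 ≤ s → s < t → t ≤ -(c ^ 2)⁻¹ → ∀ x, ‖v t x - (Literature.Analysis.FluidPDE.heatFlow (v s) (t - s) x - Literature.Analysis.FluidPDE.oseenDuhamel 1 s v v t x)‖ ≤ ε) ∧ (∀ x, ‖v (-(c ^ 2)⁻¹) x - c • R.symm (v (-1) (c • R x))‖ ≤ ε) ∧ m ≤ ‖v (-1) y₀‖ ∧ m ≤ ‖v (-1) (R y₁) - R (v (-1) y₁)‖)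

/-- Statement of stub 2 (closing lemma: defect cells ⇒ an exact cell keeping the witnesses). -/
def ClosingLemma : Prop :=
  ∀ c : ℝ, 1 < c → ∀ (R : EuclideanSpace ℝ (Fin 3) ≃ₗᵢ[ℝ] EuclideanSpace ℝ (Fin 3)) (M m : ℝ) (L : NNReal) (y₀ y₁ : EuclideanSpace ℝ (Fin 3)), (∀ ε : ℝ, 0 < ε → ∃ v : ℝ → EuclideanSpace ℝ (Fin 3) → EuclideanSpace ℝ (Fin 3), (LipschitzOnWith L (Function.uncurry v) (Set.Icc (-1 : ℝ) (-(c ^ 2)⁻¹) ×ˢ Set.univ) ∧ (∀ t ∈ Set.Icc (-1 : ℝ) (-(c ^ 2)⁻¹), ∀ x, ‖v t x‖ ≤ M) ∧ (∀ t ∈ Set.Icc (-1 : ℝ) (-(c ^ 2)⁻¹), Literature.Analysis.FluidPDE.IsWeaklyDivFree (v t)) ∧ (∀ s t : ℝ, -1 ≤ s → s < t → t ≤ -(c ^ 2)⁻¹ → ∀ x, ‖v t x - (Literature.Analysis.FluidPDE.heatFlow (v s) (t - s) x - Literature.Analysis.FluidPDE.oseenDuhamel 1 s v v t x)‖ ≤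 ε) ∧ (∀ x, ‖v (-(c ^ 2)⁻¹) x - c • R.symm (v (-1) (c • R x))‖ ≤ ε) ∧ m ≤ ‖v (-1) y₀‖ ∧ m ≤ ‖v (-1) (R y₁) - R (v (-1) y₁)‖)) → ∃ v : ℝ → EuclideanSpace ℝ (Fin 3) → EuclideanSpace ℝ (Fin 3), LipschitzOnWith L (Function.uncurry v) (Set.Icc (-1 : ℝ) (-(c ^ 2)⁻¹) ×ˢ Set.univ) ∧ (ContinuousOn (Function.uncurry v) (Set.Icc (-1 : ℝ) (-(c ^ 2)⁻¹) ×ˢ Set.univ) ∧ (∃ M : ℝ, ∀ t ∈ Set.Icc (-1 : ℝ) (-(c ^ 2)⁻¹), ∀ x, ‖v t x‖ ≤ M) ∧ (∀ t ∈ Set.Icc (-1 : ℝ) (-(c ^ 2)⁻¹), Literature.Analysis.FluidPDE.IsWeaklyDivFree (v t)) ∧ (∀ s t : ℝ, -1 ≤ s → s < t → t ≤ -(c ^ 2)⁻¹ → ∀ x, v t x = Literature.Analysis.FluidPDE.heatFlow (v s) (t - s) x - Literature.Analysis.FluidPDE.oseenDuhamel 1 s v v t x) ∧ (∀ x, v (-(c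 ^ 2)⁻¹) x = c • R.symm (v (-1) (c • R x)))) ∧ m ≤ ‖v (-1) y₀‖ ∧ m ≤ ‖v (-1) (R y₁) - R (v (-1) y₁)‖

namespace Registered

/-- Alias keyed by the registered stub name. -/
abbrev stub_approximate_cells : Prop := ApproximateCells
/-- Alias keyed by the registered stub name. -/
abbrev stub_closing_lemma : Prop := ClosingLemma

end Registered

/-! ## Registered stubs (the ONLY `sorry`s of the file; literal signatures) -/

/-- **Stub 1 (XL, open — the constructive content): defect cells with uniform bounds.** There are `c > 1`,
the quarter-turn `R`, constants `M, m > 0`, `L : ℝ≥0` and points `y₀, y₁ ∈ ℝ³` such that for every `ε > 0`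
some field `v` on the model period `[-1, -c⁻²] × ℝ³` is `L`-Lipschitz jointly in `(t,x)`, bounded by `M`,
weakly divergence free on every slice, has Oseen residual and twisted-junction residual `≤ ε` pointwise, and
satisfies `m ≤ ‖v(-1,y₀)‖`, `m ≤ ‖v(-1,Ry₁) − R v(-1,y₁)‖`. Why it might fail: uniform `(M, L, m)` as
`ε → 0` is equivalent to the ∃-piece (closing lemma + KNSS smoothing), hence fails if Type-I-in-time
quarter-turn RDSS ancient solutions do not exist (Tsai2018 Conj. 8.8–8.9; KNSS2009 Thm 5.3 axisymmetric;
ChaeWolf2017 Thm 1.3 for `c⁴ < λ_*`); measured cascades split circulation (x_Γ ≈ 0.25) instead of closing up.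
[sources: MckeownEtAl2020 (arXiv:1908.01804) p.4; BrennerHormozPumir2016 §VI eq. (19)–(25); BradshawTsai2017CPDE §1, §5; ChaeWolf2017RemovingDSS Thm 1.3; Tsai2018 Conj. 8.8–8.9] -/
theorem stub_approximate_cells :
    ∃ c : ℝ, 1 < c ∧ ∃ R : EuclideanSpace ℝ (Fin 3) ≃ₗᵢ[ℝ] EuclideanSpace ℝ (Fin 3), (∀ x : EuclideanSpace ℝ (Fin 3), (R x) 0 = -(x 1) ∧ (R x) 1 = x 0 ∧ (R x) 2 = x 2) ∧ ∃ (M m : ℝ) (L : NNReal) (y₀ y₁ : EuclideanSpace ℝ (Fin 3)), 0 < m ∧ ∀ ε : ℝ, 0 < ε → ∃ v : ℝ → EuclideanSpace ℝ (Fin 3) → EuclideanSpace ℝ (Fin 3), (LipschitzOnWith L (Function.uncurry v) (Set.Icc (-1 : ℝ) (-(c ^ 2)⁻¹) ×ˢ Set.univ) ∧ (∀ t ∈ Set.Icc (-1 : ℝ) (-(c ^ 2)⁻¹), ∀ x, ‖v t x‖ ≤ M) ∧ (∀ t ∈ Set.Icc (-1 : ℝ) (-(c ^ 2)⁻¹),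 Literature.Analysis.FluidPDE.IsWeaklyDivFree (v t)) ∧ (∀ s t : ℝ, -1 ≤ s → s < t → t ≤ -(c ^ 2)⁻¹ → ∀ x, ‖v t x - (Literature.Analysis.FluidPDE.heatFlow (v s) (t - s) x - Literature.Analysis.FluidPDE.oseenDuhamel 1 s v v t x)‖ ≤ ε) ∧ (∀ x, ‖v (-(c ^ 2)⁻¹) x - c • R.symm (v (-1) (c • R x))‖ ≤ ε) ∧ m ≤ ‖v (-1) y₀‖ ∧ m ≤ ‖v (-1) (R y₁) - R (v (-1) y₁)‖) := by
  sorry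

/-- **Stub 2 (L, provable): the closing lemma.** For `c > 1`, a linear isometry `R`, constants `M, m`,
`L : ℝ≥0` and points `y₀, y₁`: if for every `ε > 0` there is an `L`-Lipschitz, `M`-bounded, weakly
divergence-free field on the model period with Oseen and junction residuals `≤ ε` and the two witnesses,
then there is an EXACT twisted cell (jointly continuous — indeed `L`-Lipschitz —, bounded, weakly divergence
free, Oseen-mild between all pairs of model times, `v(-c⁻²,x) = c R⁻¹ v(-1,cRx)`) with the same witnesses.
Proof route: Arzelà–Ascoli + diagonal extraction along `ε = 1/n`, dominated convergence in the tested
divergence condition, the caloric term and the Oseen–Duhamel term, pointwise limits elsewhere (engine: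
`exists_oseenMild_limit_of_monotone_bound`, `AncientMildCompactness.lean`, adapted to a compact time
interval and a vanishing residual).
[sources: KNSS2009 Lemma 6.1; tree AncientMildCompactness.lean (exists_strictMono_tendstoUniformlyOn_of_bound, tendsto_oseenDuhamel_of_tendsto_of_bound)] -/
theorem stub_closing_lemma :
    ∀ c : ℝ, 1 < c → ∀ (R : EuclideanSpace ℝ (Fin 3) ≃ₗᵢ[ℝ] EuclideanSpace ℝ (Fin 3)) (M m : ℝ) (L : NNReal) (y₀ y₁ : EuclideanSpace ℝ (Fin 3)), (∀ ε : ℝ, 0 < ε → ∃ v : ℝ → EuclideanSpace ℝ (Fin 3) → EuclideanSpace ℝ (Fin 3), (LipschitzOnWith L (Function.uncurry v) (Set.Icc (-1 : ℝ) (-(c ^ 2)⁻¹) ×ˢ Set.univ) ∧ (∀ t ∈ Set.Icc (-1 : ℝ) (-(c ^ 2)⁻¹), ∀ x, ‖v t x‖ ≤ M) ∧ (∀ t ∈ Set.Icc (-1 : ℝ) (-(c ^ 2)⁻¹), Literature.Analysis.FluidPDE.IsWeaklyDivFree (v t)) ∧ (∀ s t : ℝ, -1 ≤ s → s < t → t ≤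 -(c ^ 2)⁻¹ → ∀ x, ‖v t x - (Literature.Analysis.FluidPDE.heatFlow (v s) (t - s) x - Literature.Analysis.FluidPDE.oseenDuhamel 1 s v v t x)‖ ≤ ε) ∧ (∀ x, ‖v (-(c ^ 2)⁻¹) x - c • R.symm (v (-1) (c • R x))‖ ≤ ε) ∧ m ≤ ‖v (-1) y₀‖ ∧ m ≤ ‖v (-1) (R y₁) - R (v (-1) y₁)‖)) → ∃ v : ℝ → EuclideanSpace ℝ (Fin 3) → EuclideanSpace ℝ (Fin 3), LipschitzOnWith L (Function.uncurry v) (Set.Icc (-1 : ℝ) (-(c ^ 2)⁻¹) ×ˢ Set.univ) ∧ (ContinuousOn (Function.uncurry v) (Set.Icc (-1 : ℝ) (-(c ^ 2)⁻¹) ×ˢ Set.univ) ∧ (∃ M : ℝ, ∀ t ∈ Set.Icc (-1 : ℝ) (-(c ^ 2)⁻¹), ∀ x, ‖v t x‖ ≤ M) ∧ (∀ t ∈ Set.Icc (-1 : ℝ) (-(c ^ 2)⁻¹), Literature.Analysis.FluidPDE.IsWeaklyDivFree (v t)) ∧ (∀ s t : ℝ, -1 ≤ s → s < t → t ≤ -(c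 ^ 2)⁻¹ → ∀ x, v t x = Literature.Analysis.FluidPDE.heatFlow (v s) (t - s) x - Literature.Analysis.FluidPDE.oseenDuhamel 1 s v v t x) ∧ (∀ x, v (-(c ^ 2)⁻¹) x = c • R.symm (v (-1) (c • R x)))) ∧ m ≤ ‖v (-1) y₀‖ ∧ m ≤ ‖v (-1) (R y₁) - R (v (-1) y₁)‖ := by
  sorry

/-! ## Composition (kernel-checked; no `sorry` in the closure of `TwistedCellExists_of`) -/

/-- **Composition: the two stubs imply the piece `TwistedCellExists`.** -/
theorem TwistedCellExists_of (h₁ : Registered.stub_approximate_cells)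
    (h₂ : Registered.stub_closing_lemma) : TwistedCellExists := by
  dsimp only [Registered.stub_approximate_cells, ApproximateCells, Registered.stub_closing_lemma,
    ClosingLemma] at h₁ h₂
  obtain ⟨c, hc, R, hR, M, m, L, y₀, y₁, hm, happrox⟩ := h₁
  obtain ⟨v, hLip, hcell, hy₀, hy₁⟩ := h₂ c hc R M m L y₀ y₁ happrox
  -- the initial slice of the limit cell is continuous
  have hc2 : (1 : ℝ) ≤ c ^ 2 := by nlinarith
  have hq : (c ^ 2)⁻¹ ≤ 1 := inv_le_one_of_one_le₀ hc2
  have hmem : (-1 : ℝ) ∈ Set.Icc (-1 : ℝ) (-(c ^ 2)⁻¹) := ⟨le_rfl, by linarith⟩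
  have hcont1 : Continuous (v (-1)) :=
    (hLip.continuousOn.comp_continuous (continuous_const.prodMk continuous_id)
      fun x => ⟨hmem, Set.mem_univ _⟩).congr fun _ => rfl
  refine ⟨c, hc, R, hR, v, hcell, ?_, ?_⟩
  · -- not a.e. zero: a continuous slice a.e. zero is zero, contradicting `‖v(-1,y₀)‖ ≥ m > 0`
    intro hae
    have hzero : v (-1) = 0 := Measure.eq_of_ae_eq hae hcont1 continuous_const
    have h0 : ‖v (-1) y₀‖ = 0 := by rw [hzero]; simp
    linarith
  · -- not a.e. `R`-equivariant: two continuous fields a.e. equal are equal, contradicting the twist witness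
    intro hae
    have hcl : Continuous fun x => v (-1) (R x) := hcont1.comp R.continuous
    have hcr : Continuous fun x => R (v (-1) x) := R.continuous.comp hcont1
    have heq : (fun x => v (-1) (R x)) = fun x => R (v (-1) x) := Measure.eq_of_ae_eq hae hcl hcr
    have h1 : v (-1) (R y₁) = R (v (-1) y₁) := congrFun heq y₁
    have h0 : ‖v (-1) (R y₁) - R (v (-1) y₁)‖ = 0 := by rw [h1, sub_self, norm_zero]
    linarith

/-! ## Wiring check -/

/-- The sorried stubs, with their LITERAL signatures, feed `TwistedCellExists_of` exactly as stated. -/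
theorem twistedCellExists_of_stubs : TwistedCellExists :=
  TwistedCellExists_of stub_approximate_cells stub_closing_lemma

end Summit.NavierStokesRegularity.NavierStokesRegularity.Cruxes.TwistedCellExists.Birth

end
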